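import Literature.Probability.LatticeModels.PerfectMatchingCount
import Mathlib.LinearAlgebra.Matrix.Determinant.Basic
import Mathlib.LinearAlgebra.Matrix.NonsingularInverse
import Mathlib.LinearAlgebra.Matrix.Block
import Mathlib.Combinatorics.SimpleGraph.Matching
import Mathlib.AlgebraicTopology.FundamentalGroupoid.SimplyConnected
import Mathlib.Analysis.Complex.Convex
import Mathlib.Analysis.Convex.Contractible
import HarnessLib

/-!
# The Kasteleyn matrix of a finite region of `ℤ²` (domino weighting `1`, `i`) and Kasteleyn's
# theorem / Kenyon's local statistics as a named fact

Topic `Literature/Probability/LatticeModels` (definition item `defn-kasteleynMatrix`, wanted by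
route `CriticalPhenomena/SAWScalingLimit/SAWDeterminantalDiagonal`, support item
stmt-CriticalPhenomena-8350 `DeterminantalIdentities` part (ii), and its Kasteleyn dressing
`Δ_K = 2·log pm-ratio`). Companion notion `perfectMatchingCount` (item `defn-perfectMatchingCount`)
(`PerfectMatchingCount.lean`, imported): `perfectMatchingCount G ↑V = Nat.card {M : (G.induce
↑V).Subgraph // M.IsPerfectMatching}` is the number of dimer covers of `G` on `V`.

## Contents

* Chessboard colouring of `ℤ² = Site 2`: `IsWhite x :↔ Even (x 0 + x 1)` (Kenyon 2000 §2.1),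
  `blackPart V`, `whitePart V`, the splitting `colourEquiv V : V ≃ blackPart V ⊕ whitePart V`;
  lattice neighbours have opposite colours (`isWhite_iff_not_isWhite_of_adj`).
* `kasteleynWeight x y ∈ {1, i, 0}`: Kasteleyn's flat domino weighting of `ℤ²` — `1` on horizontal
  bonds, `i` on vertical bonds (Kenyon 1997 §2.1/§3: "put weight `i = √−1` on vertical edges";
  Kenyon 2000 §3.3: any unimodular `a, b, c, d` around a square with `ac = −bd` will do).
* `kasteleynMatrix G V : Matrix V V ℂ` — THE KASTELEYN MATRIX of a graph `G` (in applications
  `G ≤ zdGraph 2`, e.g. `discreteDomainGraph Ω δ`) on a finite vertex set `V`: the full, symmetric,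
  weighted adjacency matrix `A = ((0, B), (Bᵗ, 0))` of Kenyon 1997 Thm 2 (= the matrix `K` of
  Kenyon 2000 §3.3 in the flat gauge); `kasteleynBW G V : Matrix (blackPart V) (whitePart V) ℂ` is
  its black-to-white block `B` (Kenyon 1997 (detB); Kenyon 2009 §3.4 `K(b,w)`), and
  `kasteleynMatrix_reindex_colourEquiv : K ≃ fromBlocks 0 B Bᵀ 0`. The inverse `K⁻¹` is the
  coupling function (Kenyon 2000 §4); being `V × V` it needs no identification of colours.
* PROVED linear algebra: `norm_det_kasteleynMatrix_eq_sq : ‖det K‖ = ‖det B‖²` for balanced `V`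
  (any identification `blackPart V ≃ whitePart V`); `det_kasteleynMatrix_eq_zero_of_card_ne`
  (unbalanced regions: `det K = 0`; the matching side `perfectMatchingCount_eq_zero_of_card_ne`
  is the tree's chessboard obstruction `perfectMatchingCount_eq_zero_of_ncard_ne` rephrased).
* Regions: `latticeFace a` (the four corners of the unit face with lower-left corner `a`),
  `closedFace a ⊆ ℂ` (the closed unit square), `faceUnion F`, and Kenyon's notion (1997 §2.1)
  `IsFaceSkeleton G V F` / `IsSimplyConnectedSkeleton G V`: "`G` on `V` is the 1-skeleton of a
  simply connected union of basic squares", simple connectivity being Mathlib's `IsSimplyConnected`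
  of the compact set `faceUnion F ⊆ ℂ`; sanity instance `isSimplyConnectedSkeleton_latticeFace`
  (one face; convex face unions are simply connected: `isSimplyConnected_of_convex`).
* NAMED FACT (D-0014) `Kenyon1997_prop5`: Kasteleyn's theorem with vertex deletions — for `G` on
  `V` a balanced simply connected skeleton and `S ⊆ V` carrying a perfect matching of `G`
  (the vertex set of Kenyon's disjoint edge set `E`), `‖det (kasteleynMatrix G (V ∖ S))‖ =
  (perfectMatchingCount G ↑(V ∖ S))²` (Kenyon 1997 Prop 5, with Thm 2's packaging `# = √|det A|`);
  PROVED from it: `kenyon1997_thm2` (Kasteleyn–Temperley–Fisher: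
  `‖det K_V‖ = (perfectMatchingCount G ↑V)²`, unbalanced case included) and the `B`-form
  `kenyon1997_prop5_bw : ‖det B_E‖ = perfectMatchingCount G ↑(V ∖ S)`.

## Sources (held texts read: arXiv:math/0105054 pp. 5, 8; arXiv:math-ph/9910002 pp. 4, 6, 7;
## arXiv:0910.3129 pp. 7–8)

* [Kenyon1997] R. Kenyon, *Local statistics of lattice dimers*, AIHP B 33 (1997): §2.1 (black/white,
  "simply connected subgraph = 1-skeleton of a simply connected union of basic hexagons/squares"),
  Thm 2 ("The number of perfect matchings of `H′` equals `√|det(A)|`", dominos: "put weight `i`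
  on vertical edges [Wu]"), §3 ¶1, Prop 5 (`#{matchings ⊇ E} = |det B_E|`), Thm 6
  (`= |det((B⁻¹)_{E*}) det B|`, i.e. `μ(U_E) = |det (B⁻¹)_{E*}|`).
* [Kenyon2000] R. Kenyon, *Conformal invariance of domino tiling*, Ann. Probab. 28 (2000): §2.1
  (colours), §3.3 (Kasteleyn matrix of `ℤ²`, "for a finite region |det K| is the square of the
  number of perfect matchings"; `ac = −bd`), §4 Thm 7 (coupling function `K⁻¹`).
* [Kenyon2009] R. Kenyon, *Lectures on dimers*, §3.3–3.5: Kasteleyn weighting, Lemma 1 (cycle of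
  length `2k` enclosing `ℓ` points: alternating product `(−1)^{1+k+ℓ}`), Thm 2 (`Z = |det K|`),
  Cor 3 (local statistics).
* P. W. Kasteleyn, Physica 27 (1961) 1209–1225; H. N. V. Temperley, M. E. Fisher, Phil. Mag. 6
  (1961) 1061–1063 (rectangles) — cited through [Kenyon1997].

## Not here (yet)

* A proof of `Kenyon1997_prop5` (needs Kasteleyn's sign lemma, Kenyon 2009 Lemma 1, and a Jordan
  curve argument for lattice polygons: size L).
* Kenyon 1997 Thm 6 / Kenyon 2000 Thm 7 (local statistics `μ(U_E) = |det (K⁻¹)_E|`, Jacobi's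
  complementary-minor identity applied to Prop 5) and the path-deletion ratio
  `pm(V ∖ η)/pm(V) = |det (K_V⁻¹)_{B(η)×W(η)}|`: PROVED from `Kenyon1997_prop5` in the companion
  file `KasteleynLocalStatistics.lean` (`kenyon1997_thm6_sq`, `kenyon1997_thm6`,
  `kenyon1997_thm6_path`).
* Pfaffian (non-bipartite) versions, tori (4 Pfaffians), Temperleyan domains, the `1, i, −1, −i`
  gauge of Kenyon 2000 (gauge-equivalent; same `|det|`).
-/

noncomputable section

open scoped Classical

namespace Literature.Probability.LatticeModels

open Finset Matrix

/-! ### Chessboard colouring of `ℤ²` -/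

/-- The site `x ∈ ℤ²` is **white** iff `x 0 + x 1 = ∑ i, x i` is even (Kenyon 2000, §2.1: the
unit square centred at the origin is white); otherwise it is **black**. Written with `∑ i, x i`
so as to match the chessboard lemmas of `PerfectMatchingCount.lean` literally. [cite: Kenyon2000, §2.1] -/
def IsWhite (x : Site 2) : Prop := Even (∑ i, x i)

/-- `IsWhite x ↔ x 0 + x 1` even. [cite: Kenyon2000, §2.1] -/
theorem isWhite_iff (x : Site 2) : IsWhite x ↔ Even (x 0 + x 1) := by
  rw [IsWhite, Fin.sum_univ_two]

/-- The white sites of a finite vertex set `V ⊆ ℤ²`. [cite: Kenyon2000, §2.1] -/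
def whitePart (V : Finset (Site 2)) : Finset (Site 2) := V.filter fun x => IsWhite x

/-- The black sites of a finite vertex set `V ⊆ ℤ²`. [cite: Kenyon2000, §2.1] -/
def blackPart (V : Finset (Site 2)) : Finset (Site 2) := V.filter fun x => ¬ IsWhite x

/-- Membership in `whitePart`. [folklore] -/
@[simp] theorem mem_whitePart {V : Finset (Site 2)} {x : Site 2} :
    x ∈ whitePart V ↔ x ∈ V ∧ IsWhite x := mem_filter

/-- Membership in `blackPart`. [folklore] -/
@[simp] theorem mem_blackPart {V : Finset (Site 2)} {x : Site 2} :
    x ∈ blackPart V ↔ x ∈ V ∧ ¬ IsWhite x := mem_filter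

/-- The black and white parts of `V` are disjoint. [folklore] -/
theorem disjoint_blackPart_whitePart (V : Finset (Site 2)) :
    Disjoint (blackPart V) (whitePart V) :=
  disjoint_filter.2 fun _ _ h => h

/-- `V` is the union of its black and white parts. [folklore] -/
theorem blackPart_union_whitePart (V : Finset (Site 2)) : blackPart V ∪ whitePart V = V := by
  ext x; by_cases h : IsWhite x <;> simp [h]

/-- `#V = #black + #white`. [folklore] -/
theorem card_blackPart_add_card_whitePart (V : Finset (Site 2)) :
    #(blackPart V) + #(whitePart V) = #V := by
  rw [← card_union_of_disjoint (disjoint_blackPart_whitePart V), blackPart_union_whitePart]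

/-- `ℤ²` is bipartite for the chessboard colouring: lattice neighbours have opposite colours
(the tree's `zdGraph_adj_even_sum_iff`). [folklore] -/
theorem isWhite_iff_not_isWhite_of_adj {x y : Site 2} (h : (zdGraph 2).Adj x y) :
    IsWhite x ↔ ¬ IsWhite y :=
  zdGraph_adj_even_sum_iff h

/-! ### Kasteleyn's flat weighting and the Kasteleyn matrix -/

/-- **Kasteleyn's flat domino weighting of `ℤ²`:** `ν(x, y) = 1` if `xy` is a horizontal bond
(`y = x ± e₀`), `ν(x, y) = i` if `xy` is a vertical bond (`y = x ± e₁`), and `0` if `x`, `y` are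
not lattice neighbours. Symmetric in `x`, `y`. (Kenyon 1997, §2.1 after Thm 2 and §3 ¶1: "one
must modify the adjacency matrix … put weight `i = √−1` on vertical edges"; Kenyon 2000 §3.3:
any unimodular weights `a, b, c, d` around a square with `ac = −bd` work, here
`1·1 = −(i·i)`.) [cite: Kenyon1997, §2.1 (after Thm 2) and §3 ¶1] -/
def kasteleynWeight (x y : Site 2) : ℂ :=
  if y = x + Pi.single 0 1 ∨ x = y + Pi.single 0 1 then 1
  else if y = x + Pi.single 1 1 ∨ x = y + Pi.single 1 1 then Complex.I else 0

/-- The flat weighting is symmetric. [folklore] -/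
theorem kasteleynWeight_comm (x y : Site 2) : kasteleynWeight x y = kasteleynWeight y x := by
  simp only [kasteleynWeight, or_comm]

/-- Non-neighbours get weight `0`. [folklore] -/
theorem kasteleynWeight_eq_zero_of_not_adj {x y : Site 2} (h : ¬ (zdGraph 2).Adj x y) :
    kasteleynWeight x y = 0 := by
  rw [zdGraph_adj_iff, not_exists] at h
  have h0 := h 0
  have h1 := h 1
  simp only [kasteleynWeight, if_neg h0, if_neg h1]

/-- Lattice neighbours get a weight of modulus `1`. [folklore] -/
theorem norm_kasteleynWeight_of_adj {x y : Site 2} (h : (zdGraph 2).Adj x y) :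
    ‖kasteleynWeight x y‖ = 1 := by
  unfold kasteleynWeight
  split_ifs with h0 h1
  · simp
  · simp
  · exfalso
    obtain ⟨i, hi⟩ := (zdGraph_adj_iff x y).1 h
    fin_cases i
    · exact h0 hi
    · exact h1 hi

/-- The weight is nonzero exactly on lattice bonds. [folklore] -/
theorem kasteleynWeight_ne_zero_iff {x y : Site 2} :
    kasteleynWeight x y ≠ 0 ↔ (zdGraph 2).Adj x y := by
  refine ⟨fun h => by_contra fun h' => h (kasteleynWeight_eq_zero_of_not_adj h'), fun h h0 => ?_⟩
  have := norm_kasteleynWeight_of_adj h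
  rw [h0, norm_zero] at this
  exact zero_ne_one this

/-- **The Kasteleyn matrix** of the graph `G` (a subgraph of `ℤ²` in the applications) on the
finite vertex set `V ⊆ ℤ²`: the `V × V` weighted adjacency matrix of `G` restricted to `V` for
Kasteleyn's flat domino weighting, `K(x, y) = 1` (horizontal `G`-bond), `i` (vertical `G`-bond),
`0` otherwise (in particular `0` on any `G`-edge that is not a lattice bond). This is the full
symmetric matrix `A = ((0, B), (Bᵗ, 0))` of Kenyon 1997, Thm 2 (with the domino modification
"weight `i` on vertical edges", §2.1/§3), i.e. the Kasteleyn matrix `K` of Kenyon 2000 §3.3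
with the flat gauge; its black-to-white block `B` is `kasteleynBW`. Its inverse is the
**coupling function** (Kenyon 2000, §4). [cite: Kenyon1997, Thm 2 and §3 ¶1] -/
def kasteleynMatrix (G : SimpleGraph (Site 2)) (V : Finset (Site 2)) : Matrix V V ℂ :=
  Matrix.of fun x y => if G.Adj (x : Site 2) (y : Site 2) then kasteleynWeight x y else 0

/-- Entries of the Kasteleyn matrix (definitional). [folklore] -/
theorem kasteleynMatrix_apply (G : SimpleGraph (Site 2)) (V : Finset (Site 2)) (x y : V) :
    kasteleynMatrix G V x y = if G.Adj (x : Site 2) (y : Site 2) then kasteleynWeight x y else 0 :=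
  rfl

/-- The Kasteleyn matrix (flat gauge) is symmetric. [folklore] -/
theorem kasteleynMatrix_transpose (G : SimpleGraph (Site 2)) (V : Finset (Site 2)) :
    (kasteleynMatrix G V)ᵀ = kasteleynMatrix G V := by
  ext x y
  simp only [transpose_apply, kasteleynMatrix_apply, G.adj_comm (x : Site 2), kasteleynWeight_comm]

/-- Entries between sites of the same colour vanish (the matrix is bipartite-block). [folklore] -/
theorem kasteleynMatrix_apply_eq_zero_of_isWhite_iff {G : SimpleGraph (Site 2)}
    {V : Finset (Site 2)} {x y : V} (h : IsWhite (x : Site 2) ↔ IsWhite (y : Site 2)) :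
    kasteleynMatrix G V x y = 0 := by
  rw [kasteleynMatrix_apply]
  split_ifs with hG
  · refine kasteleynWeight_eq_zero_of_not_adj fun hadj => ?_
    have := isWhite_iff_not_isWhite_of_adj hadj
    tauto
  · rfl

/-- Entries have modulus `≤ 1`, and modulus `1` exactly on the lattice bonds of `G`. [folklore] -/
theorem norm_kasteleynMatrix_apply {G : SimpleGraph (Site 2)} (hG : G ≤ zdGraph 2)
    (V : Finset (Site 2)) (x y : V) :
    ‖kasteleynMatrix G V x y‖ = if G.Adj (x : Site 2) (y : Site 2) then 1 else 0 := by
  rw [kasteleynMatrix_apply]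
  split_ifs with h
  · exact norm_kasteleynWeight_of_adj (hG h)
  · exact norm_zero

/-- **The black-to-white block `B` of the Kasteleyn matrix** (Kenyon 1997, (detB): rows indexed
by the black sites `V₀'`, columns by the white sites `V₁'`; Kenyon 2009, §3.4 "`K(b, w)`"):
`B(b, w) = K(b, w)`. [cite: Kenyon1997, Thm 2 (proof sketch, the matrix B)] -/
def kasteleynBW (G : SimpleGraph (Site 2)) (V : Finset (Site 2)) :
    Matrix (blackPart V) (whitePart V) ℂ :=
  Matrix.of fun b w => if G.Adj (b : Site 2) (w : Site 2) then kasteleynWeight b w else 0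

/-- Entries of the black-to-white block (definitional). [folklore] -/
theorem kasteleynBW_apply (G : SimpleGraph (Site 2)) (V : Finset (Site 2)) (b : blackPart V)
    (w : whitePart V) :
    kasteleynBW G V b w = if G.Adj (b : Site 2) (w : Site 2) then kasteleynWeight b w else 0 :=
  rfl

/-- The inclusion of the black part into `V`. [folklore] -/
def blackIncl (V : Finset (Site 2)) (b : blackPart V) : V := ⟨b, (mem_blackPart.1 b.2).1⟩

/-- The inclusion of the white part into `V`. [folklore] -/
def whiteIncl (V : Finset (Site 2)) (w : whitePart V) : V := ⟨w, (mem_whitePart.1 w.2).1⟩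

/-- `blackIncl` is the identity on underlying sites. [folklore] -/
@[simp] theorem coe_blackIncl (V : Finset (Site 2)) (b : blackPart V) :
    ((blackIncl V b : V) : Site 2) = b := rfl

/-- `whiteIncl` is the identity on underlying sites. [folklore] -/
@[simp] theorem coe_whiteIncl (V : Finset (Site 2)) (w : whitePart V) :
    ((whiteIncl V w : V) : Site 2) = w := rfl

/-- `B` is the black × white submatrix of `K`. [folklore] -/
theorem kasteleynMatrix_submatrix_black_white (G : SimpleGraph (Site 2)) (V : Finset (Site 2)) :
    (kasteleynMatrix G V).submatrix (blackIncl V) (whiteIncl V) = kasteleynBW G V := rfl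

/-- **Splitting `V` into colours:** the equivalence `V ≃ blackPart V ⊕ whitePart V` (blacks
first, as in Kenyon 1997, (A)). [folklore] -/
def colourEquiv (V : Finset (Site 2)) : V ≃ blackPart V ⊕ whitePart V where
  toFun x := if h : IsWhite (x : Site 2) then Sum.inr ⟨x, mem_whitePart.2 ⟨x.2, h⟩⟩
    else Sum.inl ⟨x, mem_blackPart.2 ⟨x.2, h⟩⟩
  invFun := Sum.elim (blackIncl V) (whiteIncl V)
  left_inv x := by
    by_cases h : IsWhite (x : Site 2) <;> simp [h, blackIncl, whiteIncl]
  right_inv := by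
    rintro (b | w)
    · simp [(mem_blackPart.1 b.2).2, blackIncl]
    · simp [(mem_whitePart.1 w.2).2, whiteIncl]

/-- `colourEquiv` inverts to the inclusions. [folklore] -/
@[simp] theorem colourEquiv_symm_inl (V : Finset (Site 2)) (b : blackPart V) :
    (colourEquiv V).symm (Sum.inl b) = blackIncl V b := rfl

/-- `colourEquiv` inverts to the inclusions. [folklore] -/
@[simp] theorem colourEquiv_symm_inr (V : Finset (Site 2)) (w : whitePart V) :
    (colourEquiv V).symm (Sum.inr w) = whiteIncl V w := rfl

/-- **Block form (Kenyon 1997, (A)):** ordering blacks first, `K = ((0, B), (Bᵗ, 0))`. [cite: Kenyon1997, §2.1 eq. (A) in the proof sketch of Thm 2] -/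
theorem kasteleynMatrix_reindex_colourEquiv (G : SimpleGraph (Site 2)) (V : Finset (Site 2)) :
    (kasteleynMatrix G V).reindex (colourEquiv V) (colourEquiv V) =
      Matrix.fromBlocks 0 (kasteleynBW G V) (kasteleynBW G V)ᵀ 0 := by
  ext (b | w) (b' | w')
  · simp only [reindex_apply, submatrix_apply, colourEquiv_symm_inl, fromBlocks_apply₁₁,
      Matrix.zero_apply]
    exact kasteleynMatrix_apply_eq_zero_of_isWhite_iff
      (by simp [(mem_blackPart.1 b.2).2, (mem_blackPart.1 b'.2).2])
  · rfl
  · simp only [reindex_apply, submatrix_apply, colourEquiv_symm_inl, colourEquiv_symm_inr,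
      fromBlocks_apply₂₁, transpose_apply]
    rw [← kasteleynMatrix_transpose, transpose_apply]
    rfl
  · simp only [reindex_apply, submatrix_apply, colourEquiv_symm_inr, fromBlocks_apply₂₂,
      Matrix.zero_apply]
    exact kasteleynMatrix_apply_eq_zero_of_isWhite_iff
      (by simp [(mem_whitePart.1 w.2).2, (mem_whitePart.1 w'.2).2])

/-! ### Balanced regions: `|det K| = |det B|²`; unbalanced regions: `det K = 0`, no matchings -/

/-- **`|det A| = |det B|²` (Kenyon 1997, Thm 2, proof sketch):** for a balanced region, with any
identification `e` of the black with the white sites (it only affects the sign of `det B`),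
`‖det K‖ = ‖det B‖²`. [cite: Kenyon1997, Thm 2 (proof sketch: |det B| = √|det A|)] -/
theorem norm_det_kasteleynMatrix_eq_sq (G : SimpleGraph (Site 2)) (V : Finset (Site 2))
    (e : blackPart V ≃ whitePart V) :
    ‖(kasteleynMatrix G V).det‖ = ‖((kasteleynBW G V).submatrix id e).det‖ ^ 2 := by
  set B' : Matrix (blackPart V) (blackPart V) ℂ := (kasteleynBW G V).submatrix id e with hB'
  -- `K ~ ((0, B), (Bᵀ, 0)) ~ ((0, B'), (B'ᵀ, 0))`, the last step reindexing whites by `e`.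
  have h1 : (kasteleynMatrix G V).det = (Matrix.fromBlocks 0 B' B'ᵀ 0).det := by
    rw [← det_reindex_self (colourEquiv V), kasteleynMatrix_reindex_colourEquiv,
      ← det_submatrix_equiv_self (Equiv.sumCongr (Equiv.refl (blackPart V)) e)]
    congr 1
    ext (i | i) (j | j) <;> rfl
  -- swapping the two column blocks gives the block-diagonal matrix `((B', 0), (0, B'ᵀ))`.
  have h2 : (Matrix.fromBlocks 0 B' B'ᵀ 0).submatrix id (Equiv.sumComm (blackPart V) (blackPart V)) =
      Matrix.fromBlocks B' 0 0 B'ᵀ := by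
    ext (i | i) (j | j) <;> rfl
  have h3 : ‖(Matrix.fromBlocks 0 B' B'ᵀ 0).det‖ = ‖B'.det‖ ^ 2 := by
    have := congr_arg Matrix.det h2
    rw [det_permute', det_fromBlocks_zero₂₁, det_transpose] at this
    have hn := congr_arg (fun z : ℂ => ‖z‖) this
    simp only [norm_mul] at hn
    rcases Int.units_eq_one_or (Equiv.Perm.sign (Equiv.sumComm ↥(blackPart V) ↥(blackPart V)))
      with hs | hs
    · simp only [hs, Units.val_one, Int.cast_one, norm_one, one_mul] at hn
      rw [hn, sq]
    · simp only [hs, Units.val_neg, Units.val_one, Int.cast_neg, Int.cast_one, norm_neg, norm_one,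
        one_mul] at hn
      rw [hn, sq]
  rw [h1, h3]

/-- **Unbalanced regions, determinant side:** if `#black ≠ #white` then `det K = 0` (every term
of the Leibniz expansion pairs two sites of equal colour). (Kenyon 1997, Thm 2, proof sketch:
"otherwise there are no perfect matchings (and `det(A)` is clearly `0`)".) [cite: Kenyon1997, Thm 2 (proof sketch)] -/
theorem det_kasteleynMatrix_eq_zero_of_card_ne (G : SimpleGraph (Site 2)) {V : Finset (Site 2)}
    (h : #(blackPart V) ≠ #(whitePart V)) : (kasteleynMatrix G V).det = 0 := by
  rw [det_apply]
  refine Finset.sum_eq_zero fun σ _ => ?_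
  suffices hx : ∃ x : V, kasteleynMatrix G V (σ x) x = 0 by
    obtain ⟨x, hx⟩ := hx
    rw [Finset.prod_eq_zero (f := fun i => kasteleynMatrix G V (σ i) i) (Finset.mem_univ x) hx,
      smul_zero]
  by_contra hne
  rw [not_exists] at hne
  have hcol : ∀ x : V, (IsWhite ((σ x : V) : Site 2) ↔ ¬ IsWhite ((x : V) : Site 2)) := fun x => by
    by_contra hc
    exact hne x (kasteleynMatrix_apply_eq_zero_of_isWhite_iff (by tauto))
  apply h
  rw [← Fintype.card_coe, ← Fintype.card_coe]
  apply le_antisymm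
  · -- blacks ↪ whites via `σ`
    let f : blackPart V → whitePart V := fun b =>
      ⟨σ (blackIncl V b), mem_whitePart.2 ⟨(σ (blackIncl V b)).2,
        (hcol (blackIncl V b)).2 (mem_blackPart.1 b.2).2⟩⟩
    refine Fintype.card_le_of_injective f fun b₁ b₂ hb => ?_
    have : blackIncl V b₁ = blackIncl V b₂ := σ.injective (Subtype.ext (congr_arg (fun w : whitePart V => (w : Site 2)) hb))
    exact Subtype.ext (congr_arg (fun v : V => (v : Site 2)) this)
  · -- whites ↪ blacks via `σ`
    let f : whitePart V → blackPart V := fun w =>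
      ⟨σ (whiteIncl V w), mem_blackPart.2 ⟨(σ (whiteIncl V w)).2,
        fun hw => (hcol (whiteIncl V w)).1 hw (mem_whitePart.1 w.2).2⟩⟩
    refine Fintype.card_le_of_injective f fun w₁ w₂ hw => ?_
    have : whiteIncl V w₁ = whiteIncl V w₂ := σ.injective (Subtype.ext (congr_arg (fun b : blackPart V => (b : Site 2)) hw))
    exact Subtype.ext (congr_arg (fun v : V => (v : Site 2)) this)

/-- The colour classes as `Set.ncard`s (bridge to `PerfectMatchingCount.lean`). [folklore] -/
theorem ncard_sep_isWhite (V : Finset (Site 2)) :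
    {x ∈ (V : Set (Site 2)) | IsWhite x}.ncard = #(whitePart V) := by
  rw [← Set.ncard_coe_finset (whitePart V)]
  congr 1
  ext x
  simp

/-- The colour classes as `Set.ncard`s (bridge to `PerfectMatchingCount.lean`). [folklore] -/
theorem ncard_sep_not_isWhite (V : Finset (Site 2)) :
    {x ∈ (V : Set (Site 2)) | ¬ IsWhite x}.ncard = #(blackPart V) := by
  rw [← Set.ncard_coe_finset (blackPart V)]
  congr 1
  ext x
  simp

/-- **Unbalanced regions, matching side** (the tree's colour obstruction
`perfectMatchingCount_eq_zero_of_ncard_ne`, Kenyon 2009 §3.4, in the present vocabulary): if the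
`G`-edges inside `V` are lattice bonds and `#black ≠ #white`, then `G` on `V` has no dimer cover.
[cite: Kenyon2009, §3.4] -/
theorem perfectMatchingCount_eq_zero_of_card_ne {G : SimpleGraph (Site 2)} {V : Finset (Site 2)}
    (hGV : ∀ ⦃x y : Site 2⦄, x ∈ V → y ∈ V → G.Adj x y → (zdGraph 2).Adj x y)
    (h : #(blackPart V) ≠ #(whitePart V)) : perfectMatchingCount G (V : Set (Site 2)) = 0 :=
  perfectMatchingCount_eq_zero_of_ncard_ne G (fun x => IsWhite x)
    (fun _ hx _ hy hxy => zdGraph_adj_even_sum_iff (hGV (mem_coe.1 hx) (mem_coe.1 hy) hxy))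
    (by rwa [ncard_sep_isWhite, ncard_sep_not_isWhite, ne_comm])

/-- **Balance from a matching:** if the `G`-edges inside `V` are lattice bonds and `G` on `V` has
a dimer cover, then `V` is balanced. [cite: Kenyon2009, §3.4] -/
theorem card_blackPart_eq_of_exists_isPerfectMatching {G : SimpleGraph (Site 2)}
    {V : Finset (Site 2)} (hGV : ∀ ⦃x y : Site 2⦄, x ∈ V → y ∈ V → G.Adj x y → (zdGraph 2).Adj x y)
    (hM : ∃ M : (G.induce (V : Set (Site 2))).Subgraph, M.IsPerfectMatching) :
    #(blackPart V) = #(whitePart V) := by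
  by_contra hbal
  exact (perfectMatchingCount_ne_zero_iff G V.finite_toSet).2 hM
    (perfectMatchingCount_eq_zero_of_card_ne hGV hbal)

/-- Colour counts are additive over `V = (V ∖ S) ⊔ S`. [folklore] -/
theorem card_blackPart_sdiff_add {V S : Finset (Site 2)} (hS : S ⊆ V) :
    #(blackPart (V \ S)) + #(blackPart S) = #(blackPart V) := by
  unfold blackPart
  rw [← card_union_of_disjoint (disjoint_filter_filter sdiff_disjoint), ← filter_union,
    sdiff_union_of_subset hS]

/-- Colour counts are additive over `V = (V ∖ S) ⊔ S`. [folklore] -/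
theorem card_whitePart_sdiff_add {V S : Finset (Site 2)} (hS : S ⊆ V) :
    #(whitePart (V \ S)) + #(whitePart S) = #(whitePart V) := by
  unfold whitePart
  rw [← card_union_of_disjoint (disjoint_filter_filter sdiff_disjoint), ← filter_union,
    sdiff_union_of_subset hS]

/-! ### Simply connected regions: skeleta of unions of lattice faces (Kenyon 1997, §2.1) -/

/-- The four corner sites `a`, `a + e₀`, `a + e₁`, `a + e₀ + e₁` of the **lattice face** ("basic
square") of `ℤ²` with lower-left corner `a`. [cite: Kenyon1997, §2.1 (basic squares/hexagons)] -/
def latticeFace (a : Site 2) : Finset (Site 2) :=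
  {a, a + Pi.single 0 1, a + Pi.single 1 1, a + Pi.single 0 1 + Pi.single 1 1}

/-- The closed unit square `[a₀, a₀ + 1] × [a₁, a₁ + 1] ⊆ ℂ` spanned by the lattice face with
lower-left corner `a`. [cite: Kenyon1997, §2.1 (basic squares/hexagons)] -/
def closedFace (a : Site 2) : Set ℂ :=
  {z | (a 0 : ℝ) ≤ z.re ∧ z.re ≤ a 0 + 1 ∧ (a 1 : ℝ) ≤ z.im ∧ z.im ≤ a 1 + 1}

/-- The union `⋃_{a ∈ F} [a₀, a₀+1] × [a₁, a₁+1] ⊆ ℂ` of the closed lattice faces indexed (by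
their lower-left corners) by `F`. [cite: Kenyon1997, §2.1 (union of basic squares)] -/
def faceUnion (F : Finset (Site 2)) : Set ℂ := ⋃ a ∈ F, closedFace a

/-- **`G` on `V` is the 1-skeleton of the union of the lattice faces `F`** (Kenyon 1997, §2.1:
"a subgraph of `H` … is the 1-skeleton of a … union of basic squares"): the vertices are exactly
the corners of the faces in `F`, and two of them are `G`-adjacent iff they are the two endpoints
of a side of a face in `F` (lattice neighbours lying on a common face of `F`). [cite: Kenyon1997, §2.1 (definition of a simply connected subgraph)] -/
structure IsFaceSkeleton (G : SimpleGraph (Site 2)) (V F : Finset (Site 2)) : Prop where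
  /-- the vertex set is the set of corners of the faces -/
  eq_biUnion : V = F.biUnion latticeFace
  /-- the edges inside `V` are the sides of the faces -/
  adj_iff : ∀ ⦃x y : Site 2⦄, x ∈ V → y ∈ V →
    (G.Adj x y ↔ (zdGraph 2).Adj x y ∧ ∃ a ∈ F, x ∈ latticeFace a ∧ y ∈ latticeFace a)

/-- **Simply connected subgraph of `ℤ²` (Kenyon 1997, §2.1):** "We say that a subgraph of `H` is
simply connected if it is the 1-skeleton of a simply connected union of basic squares": `G` on
`V` is the 1-skeleton of a union of lattice faces whose underlying compact set `faceUnion F ⊆ ℂ`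
is simply connected (Mathlib's `IsSimplyConnected`). [cite: Kenyon1997, §2.1 (definition of a simply connected subgraph)] -/
def IsSimplyConnectedSkeleton (G : SimpleGraph (Site 2)) (V : Finset (Site 2)) : Prop :=
  ∃ F : Finset (Site 2), IsFaceSkeleton G V F ∧ IsSimplyConnected (faceUnion F)

/-- In a face skeleton the edges inside `V` are lattice bonds. [folklore] -/
theorem IsFaceSkeleton.zdGraph_adj {G : SimpleGraph (Site 2)} {V F : Finset (Site 2)}
    (h : IsFaceSkeleton G V F) {x y : Site 2} (hx : x ∈ V) (hy : y ∈ V) (hxy : G.Adj x y) :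
    (zdGraph 2).Adj x y :=
  ((h.adj_iff hx hy).1 hxy).1

/-- Membership in a face union. [folklore] -/
theorem mem_faceUnion {F : Finset (Site 2)} {z : ℂ} :
    z ∈ faceUnion F ↔ ∃ a ∈ F, z ∈ closedFace a := by
  simp [faceUnion]

/-- A closed lattice face is convex. [folklore] -/
theorem convex_closedFace (a : Site 2) : Convex ℝ (closedFace a) := by
  have h : closedFace a = {z : ℂ | (a 0 : ℝ) ≤ z.re} ∩ {z : ℂ | z.re ≤ (a 0 : ℝ) + 1} ∩
      {z : ℂ | (a 1 : ℝ) ≤ z.im} ∩ {z : ℂ | z.im ≤ (a 1 : ℝ) + 1} := by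
    ext z; simp [closedFace, and_assoc]
  rw [h]
  exact (((convex_halfSpace_re_ge _).inter (convex_halfSpace_re_le _)).inter
    (convex_halfSpace_im_ge _)).inter (convex_halfSpace_im_le _)

/-- The corner `a` lies on its face. [folklore] -/
theorem toComplex_mem_closedFace (a : Site 2) : Site.toComplex a ∈ closedFace a := by
  simp [closedFace, Site.toComplex]

/-- Nonempty convex subsets of `ℂ` are simply connected (contractible). [folklore] -/
theorem isSimplyConnected_of_convex {s : Set ℂ} (hs : Convex ℝ s) (hne : s.Nonempty) :
    IsSimplyConnected s := by
  haveI := hs.contractibleSpace hne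
  show SimplyConnectedSpace s
  infer_instance

/-- A single closed face is simply connected. [folklore] -/
theorem isSimplyConnected_faceUnion_singleton (a : Site 2) :
    IsSimplyConnected (faceUnion {a}) := by
  have h : faceUnion {a} = closedFace a := by simp [faceUnion]
  rw [h]
  exact isSimplyConnected_of_convex (convex_closedFace a) ⟨_, toComplex_mem_closedFace a⟩

/-- **Sanity / non-vacuity:** the boundary of one lattice face (the 4-cycle of `ℤ²` on the corners
of the face `a`) is a simply connected skeleton. [folklore] -/
theorem isSimplyConnectedSkeleton_latticeFace (a : Site 2) :
    IsSimplyConnectedSkeleton (zdGraph 2) (latticeFace a) := by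
  refine ⟨{a}, ⟨by simp, fun x y hx hy => ?_⟩, isSimplyConnected_faceUnion_singleton a⟩
  exact ⟨fun h => ⟨h, a, mem_singleton_self a, hx, hy⟩, fun h => h.1⟩

/-! ### Kasteleyn's theorem and Kenyon's Proposition 5 (named fact) and their corollaries -/

/-- **Kenyon 1997, Prop. 5 with Thm 2 (Kasteleyn's theorem for dominos on a simply connected
region, also after deleting the vertices of a partial matching).** Printed (lozenge wording; §3
¶1: "the results in this section … apply verbatim for dominos, on condition that one puts weight
`i = √−1` on vertical edges in the adjacency matrix `B`"): *Thm 2.* "Let `H′` be a finite simply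
connected subgraph of `H`. The number of perfect matchings of `H′` equals `√|det(A)|`, where `A`
is the adjacency matrix of `H′`" (`A = ((0, B), (Bᵗ, 0))`, blacks first); *§3.* "Let `H′` be a
finite, balanced, simply connected subgraph of `H` … Let `E = {e₁,…,e_k}` be a subset of disjoint
edges of `H′`, with `e_j = v_{p_j} v′_{q_j}`"; *Prop. 5.* "The number of perfect matchings [of `H′`]
containing all edges in `E` is `|det(B_E)|`", `B_E` "the matrix obtained from `B` by removing all
rows `p₁,…,p_k` and all columns `q₁,…,q_k`"; and "the quantity `det(B_E)` does not depend on the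
actual set of edges in `E`, but only on the set of vertices involved".

Rendering: `H′` = `G` on `V` with `IsSimplyConnectedSkeleton G V` (Kenyon's definition, §2.1) and
`V` balanced; `E` ↦ its vertex set `S ⊆ V`, required to carry a perfect matching of `G` (the
disjoint edges `E`); the perfect matchings of `H′` containing `E` are, by restriction, the perfect
matchings of `H′ ∖ S = G.induce (V ∖ S)`, and `B_E = kasteleynBW G (V ∖ S)` is the black-to-white
block of `A_E := kasteleynMatrix G (V ∖ S)`; as in Thm 2 the statement is written for the full
weighted adjacency matrix, `|det A_E| = |det B_E|²` (`norm_det_kasteleynMatrix_eq_sq`), i.e.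
`|det A_E| = (#perfect matchings of H′ ∖ S)²`. The case `S = ∅` is Thm 2 verbatim
(`kenyon1997_thm2`); the `B`-form is `kenyon1997_prop5_bw`. Also Kasteleyn 1961 / Temperley–Fisher
1961 (rectangles), Kenyon 2000 §3.3 ("for a finite region the absolute value of the determinant of
the Kasteleyn matrix is the square of the number of perfect matchings"), Kenyon 2009 Thm 2.
Not yet proved here: the proof needs Kasteleyn's sign lemma (a lattice cycle of length `2k`
enclosing `ℓ` points has alternating weight product `(−1)^{1+k+ℓ}`, Kenyon 2009 Lemma 1) and a
Jordan-curve argument for lattice polygons. [cite: Kenyon1997, Prop 5 and Thm 2 (§3 ¶1 for dominos)] -/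
def Kenyon1997_prop5 : Prop :=
  ∀ (G : SimpleGraph (Site 2)) (V S : Finset (Site 2)),
    IsSimplyConnectedSkeleton G V → #(blackPart V) = #(whitePart V) → S ⊆ V →
    (∃ M : (G.induce (S : Set (Site 2))).Subgraph, M.IsPerfectMatching) →
    ‖(kasteleynMatrix G (V \ S)).det‖ = (perfectMatchingCount G (↑(V \ S) : Set (Site 2)) : ℝ) ^ 2

/-- The empty graph has the empty perfect matching. [folklore] -/
theorem exists_isPerfectMatching_induce_empty (G : SimpleGraph (Site 2)) :
    ∃ M : (G.induce ((∅ : Finset (Site 2)) : Set (Site 2))).Subgraph, M.IsPerfectMatching :=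
  ⟨⊥, SimpleGraph.Subgraph.isPerfectMatching_iff.2 fun v => absurd v.2 (by simp)⟩

/-- **Kasteleyn's theorem (Kenyon 1997, Thm 2, domino version), from `Kenyon1997_prop5`:**
for `G` on `V` a simply connected skeleton, `|det K| = (#perfect matchings)²`, i.e. the number of
domino tilings is `√|det A|`. (Balanced case: Prop 5 with `E = ∅`; unbalanced case: both sides
vanish, `det_kasteleynMatrix_eq_zero_of_card_ne`, `perfectMatchingCount_eq_zero_of_card_ne`.)
[cite: Kenyon1997, Thm 2 (§3 ¶1 for dominos)] -/
theorem kenyon1997_thm2 (h : Kenyon1997_prop5) {G : SimpleGraph (Site 2)} {V : Finset (Site 2)}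
    (hV : IsSimplyConnectedSkeleton G V) :
    ‖(kasteleynMatrix G V).det‖ = (perfectMatchingCount G (V : Set (Site 2)) : ℝ) ^ 2 := by
  by_cases hbal : #(blackPart V) = #(whitePart V)
  · have key := h G V ∅ hV hbal (empty_subset V) (exists_isPerfectMatching_induce_empty G)
    have hE : V \ ∅ = V := sdiff_empty
    rw [hE] at key
    exact key
  · obtain ⟨F, hF, -⟩ := hV
    rw [det_kasteleynMatrix_eq_zero_of_card_ne G hbal,
      perfectMatchingCount_eq_zero_of_card_ne (fun _ _ => hF.zdGraph_adj) hbal]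
    simp

/-- **Kenyon 1997, Prop. 5 / Thm 2 in `B`-form, from `Kenyon1997_prop5`:** for any identification
`e` of the black with the white sites of `V ∖ S` (it only affects the sign),
`|det B_E| = #{perfect matchings of H′ ∖ S}` (`S = ∅`: `|det B| = #{perfect matchings of H′}`).
[cite: Kenyon1997, Prop 5 and Thm 2 (§3 ¶1 for dominos)] -/
theorem kenyon1997_prop5_bw (h : Kenyon1997_prop5) {G : SimpleGraph (Site 2)}
    {V S : Finset (Site 2)} (hV : IsSimplyConnectedSkeleton G V) (hS : S ⊆ V)
    (hSm : ∃ M : (G.induce (S : Set (Site 2))).Subgraph, M.IsPerfectMatching)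
    (e : blackPart (V \ S) ≃ whitePart (V \ S)) :
    ‖((kasteleynBW G (V \ S)).submatrix id e).det‖ =
      perfectMatchingCount G (↑(V \ S) : Set (Site 2)) := by
  by_cases hbal : #(blackPart V) = #(whitePart V)
  · have key := h G V S hV hbal hS hSm
    rw [norm_det_kasteleynMatrix_eq_sq G (V \ S) e] at key
    exact (pow_left_inj₀ (norm_nonneg _) (Nat.cast_nonneg _) two_ne_zero).1 key
  · -- unbalanced `V` with balanced `V ∖ S` and matchable `S` cannot happen
    exfalso
    obtain ⟨F, hF, -⟩ := hV
    have hSbal : #(blackPart S) = #(whitePart S) :=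
      card_blackPart_eq_of_exists_isPerfectMatching
        (fun x y hx hy => hF.zdGraph_adj (hS hx) (hS hy)) hSm
    have hVS : #(blackPart (V \ S)) = #(whitePart (V \ S)) := by
      rw [← Fintype.card_coe, ← Fintype.card_coe, Fintype.card_congr e]
    exact hbal (by rw [← card_blackPart_sdiff_add hS, ← card_whitePart_sdiff_add hS, hSbal, hVS])

end Literature.Probability.LatticeModels

end
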